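import Summits.HodgeConjecture.HodgeConjecture.Theorems.NikulinTwinTransportTwinSimilitudeReduction

/-!
# Route NikulinTwinTransport · crux `HodgeSimilitudeAlgebraic` (stmt-HodgeConjecture-13676) —
# prime multipliers suffice

The crux `HodgeSimilitudeAlgebraic` (card item K4, ALL MULTIPLIERS): for every rational `r > 0`,
every rational, type-preserving `ℂ`-linear `r`-similitude `ψ : H²(S′(ℂ); ℂ) → H²(S(ℂ); ℂ)` between
projective K3 surfaces (`(x.y) = a·p′ ⟹ (ψx.ψy) = r a·p`, `p, p′` integral generators of `H⁴`) is
`[γ]_* = fst_* (snd^* (–) ∪ γ)` for an algebraic class `γ` of codimension `2` on `S × S′`. It is an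
open sub-case of the Hodge conjecture (Varesco, Math. Z. 305 (2023): unconditional only for `√2`,
`√3` on the Nikulin / `σ₃` loci, Thm. 2.1 / 2.9; all `r` only under the Kuga–Satake Hodge
conjecture, Thm. 0.3); `r = 1` is Buskin's theorem (`HodgeIsometryAlgebraic`, item 13675) and
`r = 2` is the route's target X (`TwinSimilitudeAlgebraic`, item 13674).

The route text's plan for the crux is "one anchor per prime … multipliers multiply and squares are
isometries (HodgeIsometryAlgebraic), so prime multipliers suffice". This file PROVES that reduction
on the route's real carriers (`complexBetti`, `cupProduct`, `complexGysin`, `algebraicClasses`),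
building on `Summit.HodgeConjecture.HodgeConjecture.Theorems.similitudeAlgebraic_of_anchor`
(file `NikulinTwinTransportTwinSimilitudeReduction.lean`, whose hypotheses (B), (C), (A) are reused
symbol for symbol — see the local notations below):

* `simAlgAt_mul_of_anchor`: the crux at multiplier `m` + an algebraic anchor `c`-similitude for every
  projective K3 surface + composition of algebraic correspondences ⟹ the crux at multiplier `c·m`
  (`Ψ⁻¹ ∘ ψ` is a rational Hodge `m`-similitude into the anchor partner; compose with `Ψ = [γ]_*`).
* `simAlgAt_div_sq`: the crux at multiplier `m` ⟹ the crux at multiplier `m / b²` for every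
  rational `b ≠ 0` ("squares are free": rescale `ψ` by `b` and the inducing class by `b⁻¹`;
  `algebraicClasses` is a `ℂ`-subspace, rational classes and Hodge types are stable under `ℚ`-scalars).
* `simAlgAt_one_iff`: the crux at multiplier `1` is `HodgeIsometryAlgebraic` (Buskin);
  `simAlgAt_two_iff`: at multiplier `2` it is the target `TwinSimilitudeAlgebraic`;
  `hodgeSimilitudeAlgebraic_iff_simAlgAt`: the crux is the conjunction over all rational `r > 0`.
* `simAlgAt_nat_of_prime_anchors`: Buskin + composition + an anchor at every PRIME multiplier ⟹ the
  crux at every positive INTEGER multiplier (induction on the prime factorisation).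
* `hodgeSimilitudeAlgebraic_of_prime_anchors`: … ⟹ the crux itself (`r = (num·den) / den²`).

So, modulo Buskin (item 13675) and the composition of algebraic correspondences between smooth
projective surfaces (hypothesis (C), Fulton *Intersection Theory* §16.1 — formal debt of the tree,
verbatim the `hC` of `similitudeAlgebraic_of_anchor`), the crux is implied by the existence, for
every prime `q` and every projective K3 surface `S`, of ONE projective K3 partner `S″` and ONE
algebraic `ℂ`-linear equivalence `Ψ : H²(S″) ≃ H²(S)` whose inverse is a rational, type-preserving
`q⁻¹`-similitude (hypothesis (A) of `similitudeAlgebraic_of_anchor` at `r = q`) — the typed form of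
"one anchor per prime, each transported as in TwinTwistorTransport". Nothing here proves the crux,
Buskin, (C) or any anchor. Prover seat prover-HodgeConjecture-route-HodgeConjecture-NikulinTwinTransport-1,
2026-08-15.
-/

noncomputable section

namespace Summit.HodgeConjecture.HodgeConjecture.Theorems.NikulinTwinTransport

open scoped Manifold
open CategoryTheory
open Literature.AlgebraicGeometry.HodgeTheory Literature.AlgebraicGeometry.Motives
open Literature.AlgebraicTopology.SingularHomology Literature.Geometry.Kaehler
open Summit.HodgeConjecture.HodgeConjecture.Theses.NikulinTwinTransport

/-- `SimAlgAt[c]`, the crux at ONE multiplier `c : ℂ`: the body of the route decl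
`HodgeSimilitudeAlgebraic` with `(r : ℂ)` replaced by `c` (so that
`HodgeSimilitudeAlgebraic ↔ ∀ r : ℚ, 0 < r → SimAlgAt[(r : ℂ)]` and
`SimAlgAt[2] ↔ TwinSimilitudeAlgebraic` hold by `Iff.rfl`, below); it is also, symbol for symbol,
the conclusion of `similitudeAlgebraic_of_anchor c`. Local notation only (no new definition). -/
local notation3 (prettyPrint := false) "SimAlgAt[" c "]" =>
  ∀ (μ : OrientationFamily), μ.HasPoincareDuality →
    ∀ (S S' : SchemeOver ℂ)
      (hS : (IsSmoothProjective 2 S ∧ Subsingleton (structureSheafCohomology S.left 1) ∧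
        ∃ (A : HodgeModel 2 S) (η : MForm 𝓘(ℝ, A.model) A.carrier ℂ 2),
          IsHolomorphicInCharts η ∧ ∀ x, η x ≠ 0))
      (hS' : (IsSmoothProjective 2 S' ∧ Subsingleton (structureSheafCohomology S'.left 1) ∧
        ∃ (A : HodgeModel 2 S') (η : MForm 𝓘(ℝ, A.model) A.carrier ℂ 2),
          IsHolomorphicInCharts η ∧ ∀ x, η x ≠ 0))
      (p : complexBetti S (2 * 2)) (p' : complexBetti S' (2 * 2)),
      (IsIntegralClass p ∧ ∀ q : complexBetti S (2 * 2), IsIntegralClass q → ∃ n : ℤ, q = n • p) →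
      (IsIntegralClass p' ∧
        ∀ q : complexBetti S' (2 * 2), IsIntegralClass q → ∃ n : ℤ, q = n • p') →
      ∀ (ψ : complexBetti S' (2 * 1) →ₗ[ℂ] complexBetti S (2 * 1)),
        (∀ x, IsRationalClass x → IsRationalClass (ψ x)) →
        (∀ (i j : ℕ) x, IsOfHodgeType 2 S' (2 * 1) i j x → IsOfHodgeType 2 S (2 * 1) i j (ψ x)) →
        (∀ (x y : complexBetti S' (2 * 1)) (a : ℂ),
          cupProduct (rfl : 2 * 1 + 2 * 1 = 2 * 2) x y = a • p' →
            cupProduct (rfl : 2 * 1 + 2 * 1 = 2 * 2) (ψ x) (ψ y) = (c * a) • p) →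
        ∃ γ ∈ algebraicClasses (MonoidalCategoryStruct.tensorObj S S') 2,
          ∀ x : complexBetti S' (2 * 1),
            ψ x = complexGysin μ (IsSmoothProjective.tensor_holds hS.1 hS'.1) hS.1
              (SemiCartesianMonoidalCategory.fst S S')
              (rfl : 2 * 1 + 2 * 2 + 2 * 2 = 2 * 1 + 2 * (2 + 2))
              (cupProduct (rfl : 2 * 1 + 2 * 2 = 2 * 1 + 2 * 2)
                (complexBetti.map (SemiCartesianMonoidalCategory.snd S S') (2 * 1) x) γ)

/-- `AnchorAt[c]`, an ALGEBRAIC ANCHOR `c`-SIMILITUDE FOR EVERY PROJECTIVE K3 SURFACE: symbol for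
symbol hypothesis (A) `hA` of `similitudeAlgebraic_of_anchor c` — every projective K3 surface `S`
(integral generator `p` of `H⁴`) has a projective K3 partner `S″` (generator `p″`) and a `ℂ`-linear
equivalence `Ψ : H²(S″(ℂ); ℂ) ≃ H²(S(ℂ); ℂ)` which is algebraic (`Ψ = [γ]_*`, `γ ∈ N² H⁴(S × S″)`)
and whose inverse is rational, type-preserving and divides the cup form by `c`. Local notation only. -/
local notation3 (prettyPrint := false) "AnchorAt[" c "]" =>
  ∀ (μ : OrientationFamily), μ.HasPoincareDuality →
    ∀ (S : SchemeOver ℂ)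
      (hS : (IsSmoothProjective 2 S ∧ Subsingleton (structureSheafCohomology S.left 1) ∧
        ∃ (A : HodgeModel 2 S) (η : MForm 𝓘(ℝ, A.model) A.carrier ℂ 2),
          IsHolomorphicInCharts η ∧ ∀ x, η x ≠ 0))
      (p : complexBetti S (2 * 2)),
      (IsIntegralClass p ∧ ∀ q : complexBetti S (2 * 2), IsIntegralClass q → ∃ n : ℤ, q = n • p) →
      ∃ (S'' : SchemeOver ℂ)
        (hS'' : (IsSmoothProjective 2 S'' ∧ Subsingleton (structureSheafCohomology S''.left 1) ∧
          ∃ (A : HodgeModel 2 S'') (η : MForm 𝓘(ℝ, A.model) A.carrier ℂ 2),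
            IsHolomorphicInCharts η ∧ ∀ x, η x ≠ 0))
        (p'' : complexBetti S'' (2 * 2)),
        (IsIntegralClass p'' ∧
          ∀ q : complexBetti S'' (2 * 2), IsIntegralClass q → ∃ n : ℤ, q = n • p'') ∧
        ∃ Ψ : complexBetti S'' (2 * 1) ≃ₗ[ℂ] complexBetti S (2 * 1),
          (∀ y, IsRationalClass y → IsRationalClass (Ψ.symm y)) ∧
          (∀ (i j : ℕ) y, IsOfHodgeType 2 S (2 * 1) i j y →
            IsOfHodgeType 2 S'' (2 * 1) i j (Ψ.symm y)) ∧
          (∀ (u v : complexBetti S (2 * 1)) (b : ℂ),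
            cupProduct (rfl : 2 * 1 + 2 * 1 = 2 * 2) u v = (c * b) • p →
              cupProduct (rfl : 2 * 1 + 2 * 1 = 2 * 2) (Ψ.symm u) (Ψ.symm v) = b • p'') ∧
          ∃ γ ∈ algebraicClasses (MonoidalCategoryStruct.tensorObj S S'') 2,
            ∀ x : complexBetti S'' (2 * 1),
              Ψ x = complexGysin μ (IsSmoothProjective.tensor_holds hS.1 hS''.1) hS.1
                (SemiCartesianMonoidalCategory.fst S S'')
                (rfl : 2 * 1 + 2 * 2 + 2 * 2 = 2 * 1 + 2 * (2 + 2))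
                (cupProduct (rfl : 2 * 1 + 2 * 2 = 2 * 1 + 2 * 2)
                  (complexBetti.map (SemiCartesianMonoidalCategory.snd S S'') (2 * 1) x) γ)

/-- `CompCorr`, COMPOSITION OF ALGEBRAIC CORRESPONDENCES between smooth projective surfaces: symbol
for symbol hypothesis (C) `hC` of `similitudeAlgebraic_of_anchor` — for algebraic
`γ ∈ N² H⁴(A × B)`, `γ₁ ∈ N² H⁴(B × C)` there is an algebraic `γ₂ ∈ N² H⁴(A × C)` with
`[γ₂]_* = [γ]_* ∘ [γ₁]_*` on `H²(C(ℂ); ℂ)` (Fulton, *Intersection Theory* §16.1; formal debt of the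
tree — Gysin base change for product squares and the moving input of
`cupProduct_mem_algebraicClasses_of_moving`). Local notation only. -/
local notation3 (prettyPrint := false) "CompCorr" =>
  ∀ (μ : OrientationFamily), μ.HasPoincareDuality →
    ∀ (A B C : SchemeOver ℂ) (hA : IsSmoothProjective 2 A) (hB : IsSmoothProjective 2 B)
      (hC : IsSmoothProjective 2 C),
      ∀ γ ∈ algebraicClasses (MonoidalCategoryStruct.tensorObj A B) 2,
        ∀ γ₁ ∈ algebraicClasses (MonoidalCategoryStruct.tensorObj B C) 2,
          ∃ γ₂ ∈ algebraicClasses (MonoidalCategoryStruct.tensorObj A C) 2,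
            ∀ x : complexBetti C (2 * 1),
              complexGysin μ (IsSmoothProjective.tensor_holds hA hC) hA
                  (SemiCartesianMonoidalCategory.fst A C)
                  (rfl : 2 * 1 + 2 * 2 + 2 * 2 = 2 * 1 + 2 * (2 + 2))
                  (cupProduct (rfl : 2 * 1 + 2 * 2 = 2 * 1 + 2 * 2)
                    (complexBetti.map (SemiCartesianMonoidalCategory.snd A C) (2 * 1) x) γ₂) =
                complexGysin μ (IsSmoothProjective.tensor_holds hA hB) hA
                  (SemiCartesianMonoidalCategory.fst A B)
                  (rfl : 2 * 1 + 2 * 2 + 2 * 2 = 2 * 1 + 2 * (2 + 2))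
                  (cupProduct (rfl : 2 * 1 + 2 * 2 = 2 * 1 + 2 * 2)
                    (complexBetti.map (SemiCartesianMonoidalCategory.snd A B) (2 * 1)
                      (complexGysin μ (IsSmoothProjective.tensor_holds hB hC) hB
                        (SemiCartesianMonoidalCategory.fst B C)
                        (rfl : 2 * 1 + 2 * 2 + 2 * 2 = 2 * 1 + 2 * (2 + 2))
                        (cupProduct (rfl : 2 * 1 + 2 * 2 = 2 * 1 + 2 * 2)
                          (complexBetti.map (SemiCartesianMonoidalCategory.snd B C) (2 * 1) x)
                          γ₁)))
                    γ)

/-- The crux `HodgeSimilitudeAlgebraic` is, by `Iff.rfl`, the conjunction of its single-multiplier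
instances `SimAlgAt[(r : ℂ)]` over all rational `r > 0`. [folklore] -/
theorem hodgeSimilitudeAlgebraic_iff_simAlgAt :
    HodgeSimilitudeAlgebraic ↔ ∀ r : ℚ, 0 < r → SimAlgAt[(r : ℂ)] :=
  Iff.rfl

/-- The route's target X (`TwinSimilitudeAlgebraic`, item stmt-HodgeConjecture-13674) is, by
`Iff.rfl`, the crux at the single multiplier `2`. [folklore] -/
theorem simAlgAt_two_iff : SimAlgAt[(2 : ℂ)] ↔ TwinSimilitudeAlgebraic :=
  Iff.rfl

/-- The crux at multiplier `1` is Buskin's theorem as rendered by the route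
(`HodgeIsometryAlgebraic`, item stmt-HodgeConjecture-13675): an isometry is a `1`-similitude
(`(1·a)·p = a·p`). [folklore] -/
theorem simAlgAt_one_iff : SimAlgAt[(1 : ℂ)] ↔ HodgeIsometryAlgebraic := by
  constructor
  · intro h μ hμ S S' hS hS' p p' hp hp' φ hφr hφt hφs
    exact h μ hμ S S' hS hS' p p' hp hp' φ hφr hφt fun x y a hxy => by rw [hφs x y a hxy, one_mul]
  · intro h μ hμ S S' hS hS' p p' hp hp' ψ hψr hψt hψs
    exact h μ hμ S S' hS hS' p p' hp hp' ψ hψr hψt fun x y a hxy => by rw [hψs x y a hxy, one_mul]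

/-- Consistency with `similitudeAlgebraic_of_anchor` (seat 0's reduction of the crux at ONE
multiplier to Buskin + composition + an anchor at that multiplier): the local notations of this
file are its hypotheses and conclusion symbol for symbol, so the term applies verbatim. [folklore] -/
theorem simAlgAt_of_anchor (c : ℂ) (hB : HodgeIsometryAlgebraic) (hC : CompCorr)
    (hA : AnchorAt[c]) : SimAlgAt[c] :=
  similitudeAlgebraic_of_anchor c hB hC hA

/-- **Multipliers multiply along anchors.** If the crux holds at multiplier `m`, algebraic
correspondences between smooth projective surfaces compose (C), and every projective K3 surface has
an algebraic anchor `c`-similitude `Ψ : H²(S″) ≃ H²(S)` (A at `c`), then the crux holds at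
multiplier `c·m`: for a rational, type-preserving `(c·m)`-similitude `ψ : H²(S′) → H²(S)`, the map
`Ψ⁻¹ ∘ ψ : H²(S′) → H²(S″)` is a rational, type-preserving `m`-similitude, hence `[γ₁]_*` by the crux
at `m` for the pair `(S″, S′)`, and `ψ = Ψ ∘ (Ψ⁻¹ ∘ ψ) = [γ]_* ∘ [γ₁]_* = [γ₂]_*` by (C). (The case
`m = 1` is `similitudeAlgebraic_of_anchor`.) [folklore] -/
theorem simAlgAt_mul_of_anchor (m c : ℂ) (hm : SimAlgAt[m]) (hC : CompCorr) (hA : AnchorAt[c]) :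
    SimAlgAt[c * m] := by
  intro μ hμ S S' hS hS' p p' hp hp' ψ hψr hψt hψs
  obtain ⟨S'', hS'', p'', hp'', Ψ, hΨr, hΨt, hΨs, γ, hγ, hΨγ⟩ := hA μ hμ S hS p hp
  -- `φ := Ψ⁻¹ ∘ ψ : H²(S′) → H²(S″)` is a rational, type-preserving `m`-similitude.
  have hφr : ∀ x, IsRationalClass x → IsRationalClass ((Ψ.symm.toLinearMap ∘ₗ ψ) x) :=
    fun x hx => hΨr _ (hψr x hx)
  have hφt : ∀ (i j : ℕ) x, IsOfHodgeType 2 S' (2 * 1) i j x →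
      IsOfHodgeType 2 S'' (2 * 1) i j ((Ψ.symm.toLinearMap ∘ₗ ψ) x) :=
    fun i j x hx => hΨt i j _ (hψt i j x hx)
  have hφs : ∀ (x y : complexBetti S' (2 * 1)) (a : ℂ),
      cupProduct (rfl : 2 * 1 + 2 * 1 = 2 * 2) x y = a • p' →
        cupProduct (rfl : 2 * 1 + 2 * 1 = 2 * 2) ((Ψ.symm.toLinearMap ∘ₗ ψ) x)
          ((Ψ.symm.toLinearMap ∘ₗ ψ) y) = (m * a) • p'' :=
    fun x y a hxy => hΨs _ _ (m * a) (by rw [hψs x y a hxy, mul_assoc])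
  -- the crux at `m` for the K3 pair `(S″, S′)`, then compose with the algebraic anchor `Ψ = [γ]_*`.
  obtain ⟨γ₁, hγ₁, hφγ₁⟩ :=
    hm μ hμ S'' S' hS'' hS' p'' p' hp'' hp' (Ψ.symm.toLinearMap ∘ₗ ψ) hφr hφt hφs
  obtain ⟨γ₂, hγ₂, hcomp⟩ := hC μ hμ S S'' S' hS.1 hS''.1 hS'.1 γ hγ γ₁ hγ₁
  refine ⟨γ₂, hγ₂, fun x => ?_⟩
  rw [hcomp x, ← hφγ₁ x, ← hΨγ]
  simp

/-- **Squares are free.** If the crux holds at multiplier `m`, it holds at multiplier `m / b²` for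
every rational `b ≠ 0`: given a rational, type-preserving `(m/b²)`-similitude `ψ`, the rescaled map
`b • ψ` is a rational (`b ∈ ℚ`), type-preserving `m`-similitude, hence `b • ψ = [γ]_*`, and then
`ψ = [b⁻¹ • γ]_*` with `b⁻¹ • γ` algebraic (`algebraicClasses` is a `ℂ`-subspace; the cup product and
the Gysin morphism are `ℂ`-linear). In particular the set of multipliers at which the crux holds is
a union of square classes of `ℚ_{>0}`. [folklore] -/
theorem simAlgAt_div_sq (m : ℂ) (b : ℚ) (hb : b ≠ 0) (hm : SimAlgAt[m]) :
    SimAlgAt[m / (b : ℂ) ^ 2] := by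
  intro μ hμ S S' hS hS' p p' hp hp' ψ hψr hψt hψs
  have hbC : (b : ℂ) ≠ 0 := by exact_mod_cast hb
  have hb2 : (b : ℂ) ^ 2 ≠ 0 := pow_ne_zero 2 hbC
  -- `b • ψ` is a rational, type-preserving `m`-similitude.
  have hψ'r : ∀ x, IsRationalClass x → IsRationalClass (((b : ℂ) • ψ) x) :=
    fun x hx => by rw [LinearMap.smul_apply]; exact (hψr x hx).smul b
  have hψ't : ∀ (i j : ℕ) x, IsOfHodgeType 2 S' (2 * 1) i j x →
      IsOfHodgeType 2 S (2 * 1) i j (((b : ℂ) • ψ) x) := by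
    intro i j x hx
    obtain ⟨A, hA⟩ := hψt i j x hx
    exact ⟨A, by rw [LinearMap.smul_apply, map_smul]; exact Submodule.smul_mem _ _ hA⟩
  have hψ's : ∀ (x y : complexBetti S' (2 * 1)) (a : ℂ),
      cupProduct (rfl : 2 * 1 + 2 * 1 = 2 * 2) x y = a • p' →
        cupProduct (rfl : 2 * 1 + 2 * 1 = 2 * 2) (((b : ℂ) • ψ) x) (((b : ℂ) • ψ) y) =
          (m * a) • p := by
    intro x y a hxy
    simp only [LinearMap.smul_apply, map_smul]
    rw [hψs x y a hxy, smul_smul, smul_smul]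
    congr 1
    calc (b : ℂ) * (b : ℂ) * (m / (b : ℂ) ^ 2 * a)
        = ((b : ℂ) ^ 2 / (b : ℂ) ^ 2) * (m * a) := by ring
      _ = m * a := by rw [div_self hb2, one_mul]
  obtain ⟨γ, hγ, hψ'γ⟩ := hm μ hμ S S' hS hS' p p' hp hp' ((b : ℂ) • ψ) hψ'r hψ't hψ's
  -- `ψ = b⁻¹ • (b • ψ) = [b⁻¹ • γ]_*`.
  refine ⟨(b : ℂ)⁻¹ • γ, Submodule.smul_mem _ _ hγ, fun x => ?_⟩
  have hx := hψ'γ x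
  rw [LinearMap.smul_apply] at hx
  rw [map_smul, map_smul, ← hx, smul_smul, inv_mul_cancel₀ hbC, one_smul]

/-- **Prime multipliers suffice — integer multipliers.** Buskin's theorem (`HodgeIsometryAlgebraic`,
the crux at multiplier `1`), the composition of algebraic correspondences (C) and an algebraic anchor
`q`-similitude for every PRIME `q` and every projective K3 surface (A at every prime) imply the crux
at every positive integer multiplier, by induction on the prime factorisation
(`simAlgAt_mul_of_anchor`). [folklore] -/
theorem simAlgAt_nat_of_prime_anchors (hB : HodgeIsometryAlgebraic) (hC : CompCorr)
    (hA : ∀ q : ℕ, q.Prime → AnchorAt[((q : ℕ) : ℂ)]) :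
    ∀ m : ℕ, 0 < m → SimAlgAt[((m : ℕ) : ℂ)] := by
  intro m
  induction m using induction_on_primes with
  | zero => exact fun h => absurd h (lt_irrefl 0)
  | one =>
    intro
    rw [Nat.cast_one]
    exact simAlgAt_one_iff.mpr hB
  | prime_mul q a hq ih =>
    intro hqa
    have ha : 0 < a := Nat.pos_of_ne_zero (by rintro rfl; simp at hqa)
    rw [Nat.cast_mul]
    exact simAlgAt_mul_of_anchor (a : ℂ) (q : ℂ) (ih ha) hC (hA q hq)

/-- **Prime multipliers suffice** (the reduction asserted by the route text for crux
`HodgeSimilitudeAlgebraic`, item stmt-HodgeConjecture-13676: "multipliers multiply and squares are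
isometries (HodgeIsometryAlgebraic), so prime multipliers suffice"). Buskin's theorem
(`HodgeIsometryAlgebraic`, item stmt-HodgeConjecture-13675), the composition of algebraic
correspondences between smooth projective surfaces (C), and — for every prime `q` — an algebraic
anchor `q`-similitude for every projective K3 surface (hypothesis (A) of
`similitudeAlgebraic_of_anchor` at `r = q`: a projective K3 partner `S″` and an algebraic
`Ψ : H²(S″) ≃ H²(S)` whose inverse is a rational, type-preserving `q⁻¹`-similitude) together imply
that EVERY rational Hodge similitude of EVERY positive rational multiplier between projective K3
surfaces is algebraic. Proof: `r = (num r · den r) / (den r)²`; the integer multiplier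
`num r · den r` is reached from `1` (Buskin) prime by prime along anchors
(`simAlgAt_nat_of_prime_anchors`), and squares of rationals are free (`simAlgAt_div_sq`).
[folklore] -/
theorem hodgeSimilitudeAlgebraic_of_prime_anchors (hB : HodgeIsometryAlgebraic) (hC : CompCorr)
    (hA : ∀ q : ℕ, q.Prime → AnchorAt[((q : ℕ) : ℂ)]) : HodgeSimilitudeAlgebraic := by
  intro r hr
  have hnum : 0 < r.num := Rat.num_pos.mpr hr
  have htoNat : 0 < r.num.toNat := by omega
  obtain ⟨m, hm⟩ : ∃ m : ℕ, m = r.num.toNat * r.den := ⟨_, rfl⟩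
  have hmpos : 0 < m := hm ▸ Nat.mul_pos htoNat r.den_pos
  have hden : (r.den : ℚ) ≠ 0 := by exact_mod_cast r.den_ne_zero
  -- `(m : ℚ) / den² = r`
  have hm' : ((m : ℕ) : ℚ) = r.num * r.den := by
    rw [hm, Nat.cast_mul]
    congr 1
    have h : ((r.num.toNat : ℕ) : ℤ) = r.num := Int.toNat_of_nonneg hnum.le
    exact_mod_cast h
  have hq : ((m : ℕ) : ℚ) / (r.den : ℚ) ^ 2 = r := by
    rw [hm', sq, mul_div_mul_right _ _ hden, Rat.num_div_den]
  have hc : ((m : ℕ) : ℂ) / ((r.den : ℚ) : ℂ) ^ 2 = (r : ℂ) := by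
    have h2 := congrArg (Rat.cast : ℚ → ℂ) hq
    simpa only [Rat.cast_div, Rat.cast_pow, Rat.cast_natCast] using h2
  have key := simAlgAt_div_sq ((m : ℕ) : ℂ) (r.den : ℚ) hden
    (simAlgAt_nat_of_prime_anchors hB hC hA m hmpos)
  rw [hc] at key
  exact key

end Summit.HodgeConjecture.HodgeConjecture.Theorems.NikulinTwinTransport

end
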